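import Mathlib.AlgebraicGeometry.Morphisms.QuasiFinite
import Mathlib.AlgebraicGeometry.Morphisms.Finite
import Mathlib.AlgebraicGeometry.Morphisms.UniversallyClosed
import Mathlib.Order.KrullDimension
import Literature.AlgebraicGeometry.Resolution.Lipman1969RationalSurfaceSingularities
import HarnessLib

/-!
# Crux `NoZenoR` / `NoZeno` (stmt-ResolutionOfSingularities-19943 / -16483), β2 descent, `stub_L1wCore` (F1) route,
# BC-2a (topological half): the integral exceptional curves under a FINITE base change

OURS (cell res-hironaka, chain W4.4; stub worker res-L0-w44-stub-2 g12; brick DAG `L1W-PREP-v2.md` 95253e48ec58b05c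
§2.1 D3/D5, brick BC-2).  Pure scheme topology over Mathlib; nothing here is a statement of the manuscript under review
(Hironaka 2017); AI-written, weaker than expert review.

Setting of (F1): `D → D_B` a finite local base change (the splitting base), `π : X → Spec D`, `X_B := X ×_D D_B` with
projections `σ : X_B → X` (finite, as a base change of `Spec D_B → Spec D`) and `π_B : X_B → Spec D_B`.  The integral
exceptional curves of `π` are recorded through their generic points `excCurvePoints π = {η | π η = 𝔪, height η = 1}`
(tree `Literature/…/Lipman1969RationalSurfaceSingularities`), the height being taken in Mathlib's specialisation
order of `X` (`Scheme.le_iff_specializes : a ≤ b ↔ b ⤳ a`, so `Order.height η` is the length of the longest chain of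
proper specialisations of `η`, the dimension of `closure {η}`).

* `Order.height` is INVARIANT under any morphism `σ : Z → X` that is a closed map with discrete fibres:
  `height_apply_le_of_isClosedMap` (a closed map lifts chains of specialisations, `IsClosedMap.closure_image_subset`),
  `strictMono_of_locallyQuasiFinite` / `height_le_height_apply` (the fibres of a locally quasi-finite morphism are
  discrete, `Scheme.Hom.isDiscrete_preimage_singleton`, so `σ` is strictly monotone for the specialisation orders),
  `height_apply_eq` (both; e.g. `σ` finite).
* For a commuting square `σ ≫ π = π_B ≫ g` with `g : Spec R_B → Spec R` whose fibre over the closed point is the closed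
  point (`g ⁻¹' {𝔪_R} = {𝔪_{R_B}}`, e.g. `R → R_B` local and integral) and `σ` universally closed and locally
  quasi-finite: `mem_excCurvePoints_iff_of_sq`, **`excCurvePoints_eq_preimage_of_sq`**
  (`excCurvePoints π_B = σ ⁻¹' excCurvePoints π`), `excCurvePoints_finite_of_sq` (finitely many curves downstairs ⇒
  finitely many upstairs, `σ` quasi-compact), `image_excCurvePoints_of_sq` / `excCurvePoints_finite_iff_of_sq`
  (`σ` surjective).
* The pullback instances: `excCurvePoints_pullback_snd`, `excCurvePoints_pullback_snd_finite_iff` for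
  `X_B = pullback π g`, `g` finite and surjective.
-/

noncomputable section

-- single-problem summit: the doubled namespace component `ResolutionOfSingularities` is forced
set_option linter.dupNamespace false

namespace Summit.ResolutionOfSingularities.ResolutionOfSingularities.Theorems.NoZeno.ExcCount

open CategoryTheory CategoryTheory.Limits AlgebraicGeometry IsLocalRing Topology
open Literature.AlgebraicGeometry.Resolution

universe u

/-! ## `Order.height` in the specialisation order under closed maps with discrete fibres -/

section Height

variable {Z X : Scheme.{u}} (σ : Z ⟶ X)

/-- **A closed map lifts chains of proper specialisations**: if `σ : Z → X` is a closed map, every chain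
`x₀ < x₁ < ⋯ < xₙ = σ z` in the specialisation order of `X` (`xₙ ⤳ xₙ₋₁ ⤳ ⋯`) lifts to a chain of the same length
in `Z` ending at `z`. [folklore] -/
theorem exists_ltSeries_last_eq_of_isClosedMap (hσ : IsClosedMap σ.base) :
    ∀ (n : ℕ) (p : LTSeries X) (z : Z), p.last = σ.base z → p.length = n →
      ∃ q : LTSeries Z, q.last = z ∧ q.length = n := by
  intro n
  induction n with
  | zero =>
    intro p z _ _
    exact ⟨RelSeries.singleton _ z, by simp, by simp⟩
  | succ n ih =>
    intro p z hlast hlen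
    have hne : p.length ≠ 0 := by omega
    -- the penultimate point `x'` of `p` is a proper specialisation of `σ z`
    have hrel : p.eraseLast.last < p.last := p.eraseLast_last_rel_last hne
    rw [hlast] at hrel
    have hspec : σ.base z ⤳ p.eraseLast.last := (Scheme.le_iff_specializes).mp hrel.le
    -- lift it along the closed map `σ`
    have hmem : p.eraseLast.last ∈ σ.base '' closure {z} := by
      have h1 : p.eraseLast.last ∈ closure {σ.base z} := specializes_iff_mem_closure.mp hspec
      have h2 : closure (σ.base '' {z}) ⊆ σ.base '' closure {z} := hσ.closure_image_subset {z}
      rw [Set.image_singleton] at h2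
      exact h2 h1
    obtain ⟨z', hz', hz'eq⟩ := hmem
    have hzz' : z ⤳ z' := specializes_iff_mem_closure.mpr hz'
    obtain ⟨q', hq'last, hq'len⟩ := ih p.eraseLast z' hz'eq.symm (by simp [hlen])
    have hlt : q'.last < z := by
      rw [hq'last, lt_iff_le_not_ge, Scheme.le_iff_specializes, Scheme.le_iff_specializes]
      refine ⟨hzz', fun h => hrel.not_ge ?_⟩
      rw [Scheme.le_iff_specializes, ← hz'eq]
      exact h.map σ.continuous
    exact ⟨q'.snoc z hlt, by simp, by simp [hq'len]⟩

/-- **`height (σ z) ≤ height z` for a closed map `σ`.** [folklore] -/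
theorem height_apply_le_of_isClosedMap (hσ : IsClosedMap σ.base) (z : Z) :
    Order.height (σ.base z) ≤ Order.height z := by
  refine Order.height_le fun p hp => ?_
  obtain ⟨q, hqlast, hqlen⟩ := exists_ltSeries_last_eq_of_isClosedMap σ hσ p.length p z hp rfl
  have h := Order.length_le_height_last (p := q)
  rw [hqlast, hqlen] at h
  exact h

/-- **A locally quasi-finite morphism is strictly monotone for the specialisation orders**: its fibres are
discrete (`Scheme.Hom.isDiscrete_preimage_singleton`), so a proper specialisation cannot collapse. [folklore] -/
theorem strictMono_of_locallyQuasiFinite [LocallyQuasiFinite σ] : StrictMono σ.base := by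
  intro a b hab
  rw [lt_iff_le_not_ge, Scheme.le_iff_specializes, Scheme.le_iff_specializes] at hab ⊢
  refine ⟨hab.1.map σ.continuous, fun hba => hab.2 ?_⟩
  -- `σ a = σ b`, so `a`, `b` lie in one (discrete) fibre, and `b ⤳ a` forces `b = a`
  have heq : σ.base a = σ.base b := ((hab.1.map σ.continuous).antisymm hba).eq.symm
  have hdisc := σ.isDiscrete_preimage_singleton (σ.base a)
  haveI : DiscreteTopology (σ.base ⁻¹' {σ.base a}) := hdisc.to_subtype
  have ha : a ∈ σ.base ⁻¹' {σ.base a} := rfl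
  have hb : b ∈ σ.base ⁻¹' {σ.base a} := by
    change σ.base b ∈ ({σ.base a} : Set X); rw [← heq]; rfl
  have hsub : (⟨b, hb⟩ : σ.base ⁻¹' {σ.base a}) ⤳ ⟨a, ha⟩ := (subtype_specializes_iff _ _).mpr hab.1
  have hba' : b = a := congrArg Subtype.val hsub.eq
  rw [hba']

/-- **`height z ≤ height (σ z)` for a locally quasi-finite `σ`.** [folklore] -/
theorem height_le_height_apply [LocallyQuasiFinite σ] (z : Z) :
    Order.height z ≤ Order.height (σ.base z) :=
  Order.height_le_height_apply_of_strictMono _ (strictMono_of_locallyQuasiFinite σ) z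

/-- **`Order.height` is invariant under a universally closed, locally quasi-finite morphism** (e.g. a finite
one): `height (σ z) = height z`. [folklore] -/
theorem height_apply_eq [UniversallyClosed σ] [LocallyQuasiFinite σ] (z : Z) :
    Order.height (σ.base z) = Order.height z :=
  le_antisymm (height_apply_le_of_isClosedMap σ σ.isClosedMap z) (height_le_height_apply σ z)

end Height

/-! ## The integral exceptional curves in a commuting square over a base change `Spec R_B → Spec R` -/

section Square

variable {R RB : Type u} [CommRing R] [IsLocalRing R] [CommRing RB] [IsLocalRing RB]
  {X XB : Scheme.{u}} (π : X ⟶ Spec (.of R)) (πB : XB ⟶ Spec (.of RB)) (σ : XB ⟶ X)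
  (g : Spec (.of RB) ⟶ Spec (.of R)) (hsq : σ ≫ π = πB ≫ g)
  (hg : g.base ⁻¹' {closedPoint R} = {closedPoint RB})

include hsq hg in
/-- In a commuting square `σ ≫ π = π_B ≫ g` with `g ⁻¹' {𝔪_R} = {𝔪_{R_B}}`: `π_B ζ` is the closed point iff
`π (σ ζ)` is. [this work] -/
theorem base_eq_closedPoint_iff_of_sq (ζ : XB) :
    πB.base ζ = closedPoint RB ↔ π.base (σ.base ζ) = closedPoint R := by
  have hcomp : π.base (σ.base ζ) = g.base (πB.base ζ) := by
    change (σ ≫ π).base ζ = (πB ≫ g).base ζ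
    rw [hsq]
  have hgs : g.base (closedPoint RB) = closedPoint R := by
    have : closedPoint RB ∈ g.base ⁻¹' {closedPoint R} := by rw [hg]; rfl
    exact this
  rw [hcomp]
  constructor
  · intro h; rw [h, hgs]
  · intro h
    have : πB.base ζ ∈ g.base ⁻¹' {closedPoint R} := h
    rw [hg] at this
    exact this

include hsq hg in
/-- **`ζ` is (the generic point of) an integral exceptional curve of `π_B` iff `σ ζ` is one of `π`**, for `σ`
universally closed and locally quasi-finite (e.g. finite): both the closed-fibre condition and `height = 1`
correspond. [this work] -/
theorem mem_excCurvePoints_iff_of_sq [UniversallyClosed σ] [LocallyQuasiFinite σ] (ζ : XB) :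
    ζ ∈ excCurvePoints πB ↔ σ.base ζ ∈ excCurvePoints π := by
  simp only [excCurvePoints, Set.mem_setOf_eq]
  rw [base_eq_closedPoint_iff_of_sq π πB σ g hsq hg ζ, height_apply_eq σ ζ]

include hsq hg in
/-- **`excCurvePoints π_B = σ ⁻¹' (excCurvePoints π)`.** [this work] -/
theorem excCurvePoints_eq_preimage_of_sq [UniversallyClosed σ] [LocallyQuasiFinite σ] :
    excCurvePoints πB = σ.base ⁻¹' excCurvePoints π := by
  ext ζ
  exact mem_excCurvePoints_iff_of_sq π πB σ g hsq hg ζ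

include hsq hg in
/-- Finitely many integral exceptional curves downstairs ⇒ finitely many upstairs (`σ` quasi-compact with finite
fibres, `Scheme.Hom.finite_preimage`). [this work] -/
theorem excCurvePoints_finite_of_sq [UniversallyClosed σ] [LocallyQuasiFinite σ] [QuasiCompact σ]
    (hfin : (excCurvePoints π).Finite) : (excCurvePoints πB).Finite := by
  rw [excCurvePoints_eq_preimage_of_sq π πB σ g hsq hg]
  exact σ.finite_preimage hfin

include hsq hg in
/-- For `σ` moreover surjective, `σ` maps the exceptional curves of `π_B` ONTO those of `π`. [this work] -/
theorem image_excCurvePoints_of_sq [UniversallyClosed σ] [LocallyQuasiFinite σ] [Surjective σ] :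
    σ.base '' excCurvePoints πB = excCurvePoints π := by
  rw [excCurvePoints_eq_preimage_of_sq π πB σ g hsq hg, Set.image_preimage_eq _ σ.surjective]

include hsq hg in
/-- For `σ` finite-like and surjective: finitely many exceptional curves upstairs iff downstairs. [this work] -/
theorem excCurvePoints_finite_iff_of_sq [UniversallyClosed σ] [LocallyQuasiFinite σ] [QuasiCompact σ]
    [Surjective σ] : (excCurvePoints πB).Finite ↔ (excCurvePoints π).Finite := by
  refine ⟨fun h => ?_, excCurvePoints_finite_of_sq π πB σ g hsq hg⟩
  rw [← image_excCurvePoints_of_sq π πB σ g hsq hg]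
  exact h.image _

include hsq hg in
/-- The fibre of `σ` over an exceptional curve of `π` consists of exceptional curves of `π_B`. [this work] -/
theorem preimage_singleton_subset_excCurvePoints_of_sq [UniversallyClosed σ] [LocallyQuasiFinite σ] {η : X}
    (hη : η ∈ excCurvePoints π) : σ.base ⁻¹' {η} ⊆ excCurvePoints πB := by
  rw [excCurvePoints_eq_preimage_of_sq π πB σ g hsq hg]
  exact Set.preimage_mono (Set.singleton_subset_iff.mpr hη)

end Square

/-! ## The pullback `X_B = X ×_{Spec R} Spec R_B` along a finite `g` -/

section Pullback

variable {R RB : Type u} [CommRing R] [IsLocalRing R] [CommRing RB] [IsLocalRing RB]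
  {X : Scheme.{u}} (π : X ⟶ Spec (.of R)) (g : Spec (.of RB) ⟶ Spec (.of R))
  (hg : g.base ⁻¹' {closedPoint R} = {closedPoint RB})

include hg in
/-- **BC-2a (topological half)**: for `g : Spec R_B → Spec R` finite with `g ⁻¹' {𝔪_R} = {𝔪_{R_B}}` and
`X_B := X ×_{Spec R} Spec R_B`, the integral exceptional curves of `π_B = pullback.snd` are exactly the points over the
integral exceptional curves of `π`: `excCurvePoints π_B = (pullback.fst) ⁻¹' excCurvePoints π`. [this work] -/
theorem excCurvePoints_pullback_snd [IsFinite g] :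
    excCurvePoints (pullback.snd π g) = (pullback.fst π g).base ⁻¹' excCurvePoints π :=
  excCurvePoints_eq_preimage_of_sq π (pullback.snd π g) (pullback.fst π g) g pullback.condition hg

include hg in
/-- Finitely many exceptional curves of `π` ⇒ finitely many of `π_B`. [this work] -/
theorem excCurvePoints_pullback_snd_finite [IsFinite g] (hfin : (excCurvePoints π).Finite) :
    (excCurvePoints (pullback.snd π g)).Finite :=
  excCurvePoints_finite_of_sq π (pullback.snd π g) (pullback.fst π g) g pullback.condition hg hfin

include hg in
/-- For `g` finite and surjective: finitely many exceptional curves of `π_B` iff of `π`. [this work] -/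
theorem excCurvePoints_pullback_snd_finite_iff [IsFinite g] [Surjective g] :
    (excCurvePoints (pullback.snd π g)).Finite ↔ (excCurvePoints π).Finite :=
  excCurvePoints_finite_iff_of_sq π (pullback.snd π g) (pullback.fst π g) g pullback.condition hg

end Pullback

end Summit.ResolutionOfSingularities.ResolutionOfSingularities.Theorems.NoZeno.ExcCount

end
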